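import Summits.BirchSwinnertonDyer.Rank1Residual.WAll.TargetAdditiveAtThreePotSSImage
import Summits.BirchSwinnertonDyer.Rank1Residual.Additive.WildThreeKrausCells
import HarnessLib
import Summits.BirchSwinnertonDyer.BirchSwinnertonDyer.Theses.CyclotomicUntwist

/-! BC3 birth skeleton for the RESIDUAL `WildSurjRankOneSupercuspidalAtThree`: Kraus split of the
supercuspidal rows into cyclic-inertia (Frobenius-inverted character, f₃ = 4) and dicyclic
(f₃ ∈ {3,5}) via the tree theorem `subW_three_iff_cyclic_or_dicyclic`. -/

set_option linter.dupNamespace false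
noncomputable section
open scoped Classical
open WeierstrassCurve Literature.NumberTheory.EllipticCurves
  Literature.NumberTheory.EllipticCurves.Rank1Residual
  Summit.BirchSwinnertonDyer.Rank1Residual.Additive

namespace Summit.BirchSwinnertonDyer.BirchSwinnertonDyer.Cruxes.WildSurjRankOneSupercuspidalAtThree.Birth

/-- stub 1: cyclic-inertia supercuspidal rows (Φ = C₃ or C₆ with Δ not a 3-adic square). -/
theorem stub_supercuspidal_cyclic :
    ∀ (W : WeierstrassCurve ℚ) [W.IsElliptic] [W.IsGloballyMinimal],
      ¬ W.HasCM → ClassO6 W 3 → Surj W 3 → SubWCyclic W →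
      ¬ (Even (padicValInt 3 W.minimalDiscriminantInt) ∧
          W.minimalDiscriminantInt / 3 ^ padicValInt 3 W.minimalDiscriminantInt % 3 = 1) →
      W.analyticRank = 1 → BSDp W 3 := by
  sorry

/-- stub 2: dicyclic rows (Φ of order 12, v₃(Δ) odd, f₃ ∈ {3,5}). -/
theorem stub_supercuspidal_dicyclic :
    ∀ (W : WeierstrassCurve ℚ) [W.IsElliptic] [W.IsGloballyMinimal],
      ¬ W.HasCM → ClassO6 W 3 → Surj W 3 → SubWDicyclic W →
      W.analyticRank = 1 → BSDp W 3 := by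
  sorry

theorem WildSurjRankOneSupercuspidalAtThree_of
    (h₁ : ∀ (W : WeierstrassCurve ℚ) [W.IsElliptic] [W.IsGloballyMinimal],
      ¬ W.HasCM → ClassO6 W 3 → Surj W 3 → SubWCyclic W →
      ¬ (Even (padicValInt 3 W.minimalDiscriminantInt) ∧
          W.minimalDiscriminantInt / 3 ^ padicValInt 3 W.minimalDiscriminantInt % 3 = 1) →
      W.analyticRank = 1 → BSDp W 3)
    (h₂ : ∀ (W : WeierstrassCurve ℚ) [W.IsElliptic] [W.IsGloballyMinimal],
      ¬ W.HasCM → ClassO6 W 3 → Surj W 3 → SubWDicyclic W →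
      W.analyticRank = 1 → BSDp W 3) :
    Summit.BirchSwinnertonDyer.BirchSwinnertonDyer.Theses.CyclotomicUntwist.WildSurjRankOneSupercuspidalAtThree := by
  intro W _ _ hCM hO6 hsurj hns hr
  rcases (subW_three_iff_cyclic_or_dicyclic W).1 hO6.2.2 with hc | hd
  · exact h₁ W hCM hO6 hsurj hc hns hr
  · exact h₂ W hCM hO6 hsurj hd hr
/-- Registered composition: the route crux BY NAME from the stubs. -/
theorem WildSurjRankOneSupercuspidalAtThree_proof : Summit.BirchSwinnertonDyer.BirchSwinnertonDyer.Theses.CyclotomicUntwist.WildSurjRankOneSupercuspidalAtThree :=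
  WildSurjRankOneSupercuspidalAtThree_of stub_supercuspidal_cyclic stub_supercuspidal_dicyclic

end Summit.BirchSwinnertonDyer.BirchSwinnertonDyer.Cruxes.WildSurjRankOneSupercuspidalAtThree.Birth
end
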